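import Summits.QuantumFields.YangMills.Theorems.UnitScaleTiltProp7CombLevelMassSlotLetters
import HarnessLib

/-!
# Route `UnitScaleTilt`, crux K1 «MinimiserStabilityRegPr» (stmt-QuantumFields-19200), LANE II (R-LEGS) — file F-9d-c0 «THE SLOT ARITHMETIC OF THE LINEAR-RESPONSE ROWS»:
# pure-real lemmas turning the sourceless cell theorem's two-slot∕pure-B letters into the three displayed slots `(Lˡ)⁻¹·SA`, `Lˡ·GA`, `e²·L^{3l}·ℓ⁻⁴·SA`

Cell `ym3-torus`, width seat `ym3-torus-px18` (gen 5); pen F-9d ≡ F-8′ (★routeR-w1 g10 12:29:20Z; ★routeR-w2 g10 12:50:30Z).  THEOREMS ONLY (0 `def`, 0 `sorry`), pure `ℝ`;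
`--supports stmt-QuantumFields-19200 --as helper`, count-neutral.  YM₃ on T³ is a ladder rung (R3), not the Clay problem; nothing here claims any row of the display.

THE POINT.  With the letters of ✓F-9d-a `Prop7CornerCombLinTowerCellRows.sum_cell_linTower_rows` read on `T³` at tower height `k := l` — `m₀² = SA`, `g₀² = GA`, `(ρˡ)² = (Lˡ)⁻¹ =: Linv`,
`((ρ⁻¹)ˡ)² = Lˡ =: Ll`, `ρ^{2l} = Linv`, `cB0² = 2·wG·r·(g₀ + θ_g·E·m₀·ρ^{2l}·K₃)²`, `cA² = 2·ΘM·r·(E·m₀)²`, `θ_g = C_g·e·s`, `ΘM = CΘ·(4e·s)²` (`s = ρ^{4(K−n−l)}` the scaled cap's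
ratio) and the anchor `s²·Linv²·Ll = W` — ★ `mass_three_slots`: `MASS ≤ 2ER²·Linv·SA + 16wG·r·Ll·GA + C·ER²·(e²·W·SA)`; ★ `grad_two_slots`: `GRAD ≤ (4 + 64d·wG·r)·Ll·GA + C′·ER²·(e²·W·SA)`;
★ `anchor_arith_T3`: `(ρ^{4(k₀−l)})²·((Lˡ)⁻¹)²·Lˡ = L^{3l}·((L^{k₀})⁴)⁻¹` (`ρ = (√L)⁻¹`), i.e. `W = L^{3l}·ℓ⁻⁴` at `k₀ := K − n`.
HONEST SCOPE.  `nlinarith`-free bookkeeping (explicit products + `linarith`); the analysis is in F-9d-a∕b and the member file.  [Balaban1985Variational] (2), (106)–(111) p.294;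
[Balaban1987RG1] (0.4) p.253.
-/

set_option autoImplicit false

noncomputable section

namespace Summit.QuantumFields.YangMills.Theorems.Prop7RLegsLinTowerSlots

open Summit.QuantumFields.YangMills.Theorems.Prop7CombLevelMassSlotLetters (rho_pow_four_mul)

/-- `(a + b)² ≤ 2a² + 2b²` (file-local copy of a one-liner). -/
private theorem add_sq_le_two_sq (a b : ℝ) : (a + b) ^ 2 ≤ 2 * a ^ 2 + 2 * b ^ 2 := by
  nlinarith [sq_nonneg (a - b)]

/-- ★ **MASS SLOTS.**  From the two-slot cell mass `MASS ≤ 2(E·m₀)²(ρˡ)² + 2(cB0 + cA·ρ^{2l})²((ρ⁻¹)ˡ)²` with the letters read on `T³` (`(ρˡ)² = ρ^{2l} = Linv`, `((ρ⁻¹)ˡ)² = Ll`,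
`Linv·Ll = 1`), the level-0 currencies `m₀² = SA`, `g₀² = GA`, the chosen constants `cB0² = 2wG·r·Ĝ²` (`Ĝ = g₀ + θ_g·E·m₀·ρ^{2l}·K₃`), `cA² = 2ΘM·r·(E·m₀)²`, the SCALED windows
`θ_g = Cg·e·s`, `ΘM = CΘ·(4·e·s)²` and the anchor identity `s²·Linv²·Ll = W` (on `T³`: `s = ρ^{4(K−n−l)}`, `W = L^{3l}·ℓ⁻⁴`), with `E ≤ ER`:
`MASS ≤ 2ER²·Linv·SA + 16wG·r·Ll·GA + (16wG·r·Cg²·K₃² + 128·CΘ·r)·ER²·e²·W·SA`. [bookkeeping; cite: Balaban1985Variational, (106)-(111) p.294] -/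
theorem mass_three_slots {MASS SA GA E ER m₀ g₀ ρl ρil ρ2l cB0 cA wG r θg Cg e s ΘM CΘ Ll Linv W K₃ : ℝ}
    (hMASS : MASS ≤ 2 * ((E * m₀) ^ 2 * ρl ^ 2) + 2 * ((cB0 + cA * ρ2l) ^ 2 * ρil ^ 2))
    (hm₀ : m₀ ^ 2 = SA) (hg₀ : g₀ ^ 2 = GA) (hρl : ρl ^ 2 = Linv) (hρil : ρil ^ 2 = Ll) (hρ2l : ρ2l = Linv)
    (hcB0 : cB0 ^ 2 = 2 * wG * r * (g₀ + θg * E * m₀ * ρ2l * K₃) ^ 2) (hcA : cA ^ 2 = 2 * ΘM * r * (E * m₀) ^ 2)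
    (hθg : θg = Cg * e * s) (hΘM : ΘM = CΘ * (4 * e * s) ^ 2) (hW : s ^ 2 * Linv ^ 2 * Ll = W)
    (hE0 : 0 ≤ E) (hE : E ≤ ER) (hSA : 0 ≤ SA) (hwG : 0 ≤ wG) (hr : 0 ≤ r) (hLl : 0 ≤ Ll) (hLinv : 0 ≤ Linv) (hCΘ : 0 ≤ CΘ) :
    MASS ≤ 2 * ER ^ 2 * Linv * SA + 16 * wG * r * Ll * GA + (16 * wG * r * Cg ^ 2 * K₃ ^ 2 + 128 * CΘ * r) * ER ^ 2 * (e ^ 2 * W * SA) := by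
  have hE2 : E ^ 2 ≤ ER ^ 2 := pow_le_pow_left₀ hE0 hE 2
  have hW0 : 0 ≤ W := by rw [← hW]; positivity
  -- the letters, as products of atoms
  obtain ⟨X, hX⟩ : ∃ X : ℝ, X = e ^ 2 * W * SA := ⟨_, rfl⟩
  have hX0 : 0 ≤ X := by rw [hX]; positivity
  have h1 : 2 * ((E * m₀) ^ 2 * ρl ^ 2) = 2 * E ^ 2 * (Linv * SA) := by rw [mul_pow, hm₀, hρl]; ring
  have hT : (θg * E * m₀ * ρ2l * K₃) ^ 2 * Ll = Cg ^ 2 * K₃ ^ 2 * E ^ 2 * X := by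
    rw [hX, ← hW, hθg, hρ2l]
    have : (Cg * e * s * E * m₀ * Linv * K₃) ^ 2 * Ll = Cg ^ 2 * K₃ ^ 2 * E ^ 2 * (e ^ 2 * (s ^ 2 * Linv ^ 2 * Ll) * m₀ ^ 2) := by ring
    rw [this, hm₀]
  have hAterm : cA ^ 2 * ρ2l ^ 2 * Ll = 32 * CΘ * r * E ^ 2 * X := by
    rw [hX, ← hW, hcA, hΘM, hρ2l]
    have : 2 * (CΘ * (4 * e * s) ^ 2) * r * (E * m₀) ^ 2 * Linv ^ 2 * Ll = 32 * CΘ * r * E ^ 2 * (e ^ 2 * (s ^ 2 * Linv ^ 2 * Ll) * m₀ ^ 2) := by ring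
    rw [this, hm₀]
  -- squares of sums
  have h2 : (cB0 + cA * ρ2l) ^ 2 ≤ 2 * cB0 ^ 2 + 2 * (cA ^ 2 * ρ2l ^ 2) := by rw [← mul_pow]; exact add_sq_le_two_sq _ _
  have h3 : (g₀ + θg * E * m₀ * ρ2l * K₃) ^ 2 ≤ 2 * g₀ ^ 2 + 2 * (θg * E * m₀ * ρ2l * K₃) ^ 2 := add_sq_le_two_sq _ _
  -- the B part
  have hB1 : 2 * ((cB0 + cA * ρ2l) ^ 2 * ρil ^ 2) ≤ 4 * (cB0 ^ 2 * Ll) + 4 * (cA ^ 2 * ρ2l ^ 2 * Ll) := by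
    rw [hρil]
    have := mul_le_mul_of_nonneg_right h2 hLl
    have e1 : (2 * cB0 ^ 2 + 2 * (cA ^ 2 * ρ2l ^ 2)) * Ll = 2 * (cB0 ^ 2 * Ll) + 2 * (cA ^ 2 * ρ2l ^ 2 * Ll) := by ring
    rw [e1] at this
    linarith
  have hB2 : cB0 ^ 2 * Ll ≤ 4 * wG * r * (Ll * GA) + 4 * wG * r * Cg ^ 2 * K₃ ^ 2 * E ^ 2 * X := by
    rw [hcB0]
    have := mul_le_mul_of_nonneg_right (mul_le_mul_of_nonneg_left h3 (by positivity : 0 ≤ 2 * wG * r)) hLl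
    have e1 : 2 * wG * r * (2 * g₀ ^ 2 + 2 * (θg * E * m₀ * ρ2l * K₃) ^ 2) * Ll
        = 4 * wG * r * (Ll * g₀ ^ 2) + 4 * wG * r * ((θg * E * m₀ * ρ2l * K₃) ^ 2 * Ll) := by ring
    rw [e1, hT, hg₀] at this
    linarith
  -- assemble at `E`, then `E ≤ ER`
  have hmain : MASS ≤ 2 * E ^ 2 * (Linv * SA) + 16 * wG * r * (Ll * GA) + (16 * wG * r * Cg ^ 2 * K₃ ^ 2 + 128 * CΘ * r) * E ^ 2 * X := by
    have := hMASS; rw [h1] at this; rw [hAterm] at hB1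
    linarith [this, hB1, hB2]
  have hx1 : 2 * E ^ 2 * (Linv * SA) ≤ 2 * ER ^ 2 * (Linv * SA) :=
    mul_le_mul_of_nonneg_right (mul_le_mul_of_nonneg_left hE2 (by norm_num)) (by positivity)
  have hx2 : (16 * wG * r * Cg ^ 2 * K₃ ^ 2 + 128 * CΘ * r) * E ^ 2 * X ≤ (16 * wG * r * Cg ^ 2 * K₃ ^ 2 + 128 * CΘ * r) * ER ^ 2 * X := by
    have hc : 0 ≤ 16 * wG * r * Cg ^ 2 * K₃ ^ 2 + 128 * CΘ * r := by positivity
    exact mul_le_mul_of_nonneg_right (mul_le_mul_of_nonneg_left hE2 hc) hX0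
  have e2 : 2 * ER ^ 2 * Linv * SA + 16 * wG * r * Ll * GA + (16 * wG * r * Cg ^ 2 * K₃ ^ 2 + 128 * CΘ * r) * ER ^ 2 * (e ^ 2 * W * SA)
      = 2 * ER ^ 2 * (Linv * SA) + 16 * wG * r * (Ll * GA) + (16 * wG * r * Cg ^ 2 * K₃ ^ 2 + 128 * CΘ * r) * ER ^ 2 * X := by rw [hX]; ring
  rw [e2]
  linarith

/-- ★ **GRADIENT SLOTS.**  From the pure-B cell gradient `GRAD ≤ (2Ĝ² + 8d(cB0 + cA·ρ^{2l})²)·((ρ⁻¹)ˡ)²` with the same letters: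
`GRAD ≤ (4 + 64d·wG·r)·Ll·GA + (4·Cg²·K₃² + 64d·wG·r·Cg²·K₃² + 512d·CΘ·r)·ER²·e²·W·SA`. [bookkeeping; cite: Balaban1987RG1, (0.4) p.253] -/
theorem grad_two_slots {GRAD SA GA E ER m₀ g₀ ρil ρ2l cB0 cA wG r θg Cg e s ΘM CΘ Ll Linv W K₃ dd : ℝ}
    (hGRAD : GRAD ≤ (2 * (g₀ + θg * E * m₀ * ρ2l * K₃) ^ 2 + 8 * dd * (cB0 + cA * ρ2l) ^ 2) * ρil ^ 2)
    (hm₀ : m₀ ^ 2 = SA) (hg₀ : g₀ ^ 2 = GA) (hρil : ρil ^ 2 = Ll) (hρ2l : ρ2l = Linv)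
    (hcB0 : cB0 ^ 2 = 2 * wG * r * (g₀ + θg * E * m₀ * ρ2l * K₃) ^ 2) (hcA : cA ^ 2 = 2 * ΘM * r * (E * m₀) ^ 2)
    (hθg : θg = Cg * e * s) (hΘM : ΘM = CΘ * (4 * e * s) ^ 2) (hW : s ^ 2 * Linv ^ 2 * Ll = W)
    (hE0 : 0 ≤ E) (hE : E ≤ ER) (hSA : 0 ≤ SA) (hwG : 0 ≤ wG) (hr : 0 ≤ r) (hLl : 0 ≤ Ll) (hCΘ : 0 ≤ CΘ) (hdd : 0 ≤ dd) :
    GRAD ≤ (4 + 64 * dd * wG * r) * Ll * GA + (4 * Cg ^ 2 * K₃ ^ 2 + 64 * dd * wG * r * Cg ^ 2 * K₃ ^ 2 + 512 * dd * CΘ * r) * ER ^ 2 * (e ^ 2 * W * SA) := by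
  have hE2 : E ^ 2 ≤ ER ^ 2 := pow_le_pow_left₀ hE0 hE 2
  have hW0 : 0 ≤ W := by rw [← hW]; positivity
  obtain ⟨X, hX⟩ : ∃ X : ℝ, X = e ^ 2 * W * SA := ⟨_, rfl⟩
  have hX0 : 0 ≤ X := by rw [hX]; positivity
  have hT : (θg * E * m₀ * ρ2l * K₃) ^ 2 * Ll = Cg ^ 2 * K₃ ^ 2 * E ^ 2 * X := by
    rw [hX, ← hW, hθg, hρ2l]
    have : (Cg * e * s * E * m₀ * Linv * K₃) ^ 2 * Ll = Cg ^ 2 * K₃ ^ 2 * E ^ 2 * (e ^ 2 * (s ^ 2 * Linv ^ 2 * Ll) * m₀ ^ 2) := by ring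
    rw [this, hm₀]
  have hAterm : cA ^ 2 * ρ2l ^ 2 * Ll = 32 * CΘ * r * E ^ 2 * X := by
    rw [hX, ← hW, hcA, hΘM, hρ2l]
    have : 2 * (CΘ * (4 * e * s) ^ 2) * r * (E * m₀) ^ 2 * Linv ^ 2 * Ll = 32 * CΘ * r * E ^ 2 * (e ^ 2 * (s ^ 2 * Linv ^ 2 * Ll) * m₀ ^ 2) := by ring
    rw [this, hm₀]
  have h2 : (cB0 + cA * ρ2l) ^ 2 ≤ 2 * cB0 ^ 2 + 2 * (cA ^ 2 * ρ2l ^ 2) := by rw [← mul_pow]; exact add_sq_le_two_sq _ _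
  have h3 : (g₀ + θg * E * m₀ * ρ2l * K₃) ^ 2 ≤ 2 * g₀ ^ 2 + 2 * (θg * E * m₀ * ρ2l * K₃) ^ 2 := add_sq_le_two_sq _ _
  have hĜ : (g₀ + θg * E * m₀ * ρ2l * K₃) ^ 2 * Ll ≤ 2 * (Ll * GA) + 2 * Cg ^ 2 * K₃ ^ 2 * E ^ 2 * X := by
    have := mul_le_mul_of_nonneg_right h3 hLl
    have e1 : (2 * g₀ ^ 2 + 2 * (θg * E * m₀ * ρ2l * K₃) ^ 2) * Ll = 2 * (Ll * g₀ ^ 2) + 2 * ((θg * E * m₀ * ρ2l * K₃) ^ 2 * Ll) := by ring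
    rw [e1, hT, hg₀] at this
    linarith
  have hB2 : cB0 ^ 2 * Ll ≤ 2 * wG * r * (2 * (Ll * GA) + 2 * Cg ^ 2 * K₃ ^ 2 * E ^ 2 * X) := by
    rw [hcB0, mul_assoc]
    exact mul_le_mul_of_nonneg_left hĜ (by positivity)
  have hsplit : GRAD ≤ 2 * ((g₀ + θg * E * m₀ * ρ2l * K₃) ^ 2 * Ll) + 8 * dd * (2 * (cB0 ^ 2 * Ll) + 2 * (cA ^ 2 * ρ2l ^ 2 * Ll)) := by
    rw [hρil] at hGRAD
    have h2' := mul_le_mul_of_nonneg_left (mul_le_mul_of_nonneg_right h2 hLl) (by positivity : 0 ≤ 8 * dd)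
    have e1 : (2 * (g₀ + θg * E * m₀ * ρ2l * K₃) ^ 2 + 8 * dd * (cB0 + cA * ρ2l) ^ 2) * Ll
        = 2 * ((g₀ + θg * E * m₀ * ρ2l * K₃) ^ 2 * Ll) + 8 * dd * ((cB0 + cA * ρ2l) ^ 2 * Ll) := by ring
    have e2 : 8 * dd * ((2 * cB0 ^ 2 + 2 * (cA ^ 2 * ρ2l ^ 2)) * Ll) = 8 * dd * (2 * (cB0 ^ 2 * Ll) + 2 * (cA ^ 2 * ρ2l ^ 2 * Ll)) := by ring
    rw [e1] at hGRAD; rw [e2] at h2'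
    linarith
  have hmain : GRAD ≤ (4 + 64 * dd * wG * r) * (Ll * GA) + (4 * Cg ^ 2 * K₃ ^ 2 + 64 * dd * wG * r * Cg ^ 2 * K₃ ^ 2 + 512 * dd * CΘ * r) * E ^ 2 * X := by
    rw [hAterm] at hsplit
    have hB2' := mul_le_mul_of_nonneg_left hB2 (by positivity : 0 ≤ 16 * dd)
    linarith [hsplit, hĜ, hB2']
  have hx2 : (4 * Cg ^ 2 * K₃ ^ 2 + 64 * dd * wG * r * Cg ^ 2 * K₃ ^ 2 + 512 * dd * CΘ * r) * E ^ 2 * X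
      ≤ (4 * Cg ^ 2 * K₃ ^ 2 + 64 * dd * wG * r * Cg ^ 2 * K₃ ^ 2 + 512 * dd * CΘ * r) * ER ^ 2 * X := by
    have hc : 0 ≤ 4 * Cg ^ 2 * K₃ ^ 2 + 64 * dd * wG * r * Cg ^ 2 * K₃ ^ 2 + 512 * dd * CΘ * r := by positivity
    exact mul_le_mul_of_nonneg_right (mul_le_mul_of_nonneg_left hE2 hc) hX0
  have e2 : (4 + 64 * dd * wG * r) * Ll * GA + (4 * Cg ^ 2 * K₃ ^ 2 + 64 * dd * wG * r * Cg ^ 2 * K₃ ^ 2 + 512 * dd * CΘ * r) * ER ^ 2 * (e ^ 2 * W * SA)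
      = (4 + 64 * dd * wG * r) * (Ll * GA) + (4 * Cg ^ 2 * K₃ ^ 2 + 64 * dd * wG * r * Cg ^ 2 * K₃ ^ 2 + 512 * dd * CΘ * r) * ER ^ 2 * X := by rw [hX]; ring
  rw [e2]
  linarith

/-- The `T³` anchor arithmetic: with `ρ = (√L)⁻¹` (`1 < L`), `Ll := Lˡ`, `Linv := (Lˡ)⁻¹`, `s := ρ^{4(K−n−l)}` and `l ≤ K − n`:
`s²·Linv²·Ll = L^{3l}·((L^{K−n})⁴)⁻¹`, `Linv·Ll = 1`, `ρ^{2l} = Linv`. [folklore] -/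
theorem anchor_arith_T3 {L : ℝ} (hL : 0 < L) {l k₀ : ℕ} (hl : l ≤ k₀) :
    (((Real.sqrt L)⁻¹) ^ (4 * (k₀ - l))) ^ 2 * ((L ^ l)⁻¹) ^ 2 * L ^ l = L ^ (3 * l) * ((L ^ k₀) ^ 4)⁻¹
    ∧ (L ^ l)⁻¹ * L ^ l = 1 ∧ ((Real.sqrt L)⁻¹) ^ (2 * l) = (L ^ l)⁻¹ := by
  have hL0 : L ≠ 0 := hL.ne'
  obtain ⟨s, rfl⟩ := Nat.exists_eq_add_of_le hl
  refine ⟨?_, inv_mul_cancel₀ (pow_ne_zero _ hL0), by rw [pow_mul, inv_pow, Real.sq_sqrt hL.le, inv_pow]⟩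
  rw [show l + s - l = s by omega, rho_pow_four_mul hL s]
  have h3 : L ^ (3 * l) = (L ^ l) ^ 3 := by rw [← pow_mul, mul_comm]
  rw [h3, pow_add]
  field_simp

end Summit.QuantumFields.YangMills.Theorems.Prop7RLegsLinTowerSlots

end
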